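import Literature.NumberTheory.Sieve.LinearEquationsInPrimesEnvelopingSieveCorrelations
import Literature.NumberTheory.Sieve.LinearEquationsInPrimesEnvelopingSieveGYLinearForms
import Literature.NumberTheory.Sieve.LinearEquationsInPrimesEnvelopingSieveGYCorrelations
import Literature.NumberTheory.Sieve.LinearEquationsInPrimesGvN
import HarnessLib

/-!
# The enveloping sieve: Prop. 6.4 and the Green–Tao–Ziegler theorem from the Goldston–Yıldırım displays

Trunk T-SIEVE (`Literature/NumberTheory/Sieve`). Capstone of the App. D layer of the decomposition
of `Literature.NumberTheory.Sieve.GreenTaoZiegler2012_finiteComplexity` (B. Green, T. Tao, *Linear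
equations in primes*, Ann. of Math. 171 (2010)): the pseudorandom majorant Prop. 6.4
(`GreenTao2010_pseudorandomDomination`) follows from the two displayed consequences of the
Goldston–Yıldırım estimate Thm. D.3 vendored in `LinearEquationsInPrimesEnvelopingSieveFacts.lean`
((D.8) and the correlation estimate), by the measure of `…EnvelopingSieveMeasure.lean`, the linear
forms verification of `…EnvelopingSieveLinearForms.lean` and the correlation verification of
`…EnvelopingSieveCorrelations.lean`; combined with the proved reductions of §§4, 5, 7 and App. C
(`…GvN.lean`), the Green–Tao–Ziegler theorem then rests on those two displays and on the Gowers
uniformity estimate Thm. 7.2 (`GreenTao2010_gowersUniformity`, from `GI(s)` and `MN(s)`).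

## References

* B. Green, T. Tao, *Linear equations in primes*, Ann. of Math. (2) 171 (2010), 1753–1850
  (arXiv:math/0606088): Prop. 6.4, Thm. 7.2, App. D (Thm. D.3, proof of Prop. 6.4), Main Theorem.
* B. Green, T. Tao, T. Ziegler, *An inverse theorem for the Gowers `U^{s+1}[N]`-norm*, Ann. of
  Math. (2) 176 (2012), Thm. 1.3 and the paragraph following it.
-/

namespace Literature.NumberTheory.Sieve

/-- **Prop. 6.4 from the two Goldston–Yıldırım displays** (Green–Tao 2010, App. D, proof of
Prop. 6.4): the linear forms display (D.8) and the correlation estimate imply the existence of the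
pseudorandom majorant. [cite: GreenTao2010, Prop. 6.4 and App. D (proof of Prop. 6.4)] -/
theorem GreenTao2010_pseudorandomDomination_of_linearForms_of_correlations
    (h₁ : GreenTao2010_envelopingSieve_linearForms)
    (h₂ : GreenTao2010_envelopingSieve_correlations) : GreenTao2010_pseudorandomDomination :=
  GreenTao2010_pseudorandomDomination_of_envelopingSieveMeasure
    (GreenTao2010_envelopingSieve_linearFormsCondition_of_linearForms h₁)
    (GreenTao2010_envelopingSieve_correlationCondition_of_linearForms_of_correlations h₁ h₂)

/-- **The Green–Tao–Ziegler theorem from the Goldston–Yıldırım displays and the Gowers uniformity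
estimate**: with §§4, 5, 7, App. C and now App. D (relative to Thm. D.3's two displays) discharged,
`GreenTaoZiegler2012_finiteComplexity` follows from the two displays and Thm. 7.2 (`GI(s)`,
`MN(s)`). [cite: GreenTao2010, Main Theorem, Prop. 6.4, Thm. 7.2]
[cite: GreenTaoZiegler2012, Thm. 1.3 and the following paragraph] -/
theorem GreenTaoZiegler2012_finiteComplexity_of_linearForms_of_correlations_of_gowersUniformity
    (h₁ : GreenTao2010_envelopingSieve_linearForms) (h₂ : GreenTao2010_envelopingSieve_correlations)
    (hU : GreenTao2010_gowersUniformity) : GreenTaoZiegler2012_finiteComplexity :=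
  GreenTaoZiegler2012_finiteComplexity_of_pseudorandomDomination_of_gowersUniformity
    (GreenTao2010_pseudorandomDomination_of_linearForms_of_correlations h₁ h₂) hU

/-- **Prop. 6.4 from the correlation display alone**: the linear forms display (D.8) being proved
(`GreenTao2010_envelopingSieve_linearForms_holds`, from the smooth Goldston–Yıldırım engine), the
pseudorandom majorant of Prop. 6.4 rests on the correlation estimate of App. D only.
[cite: GreenTao2010, Prop. 6.4 and App. D (proof of Prop. 6.4)] -/
theorem GreenTao2010_pseudorandomDomination_of_correlations
    (h₂ : GreenTao2010_envelopingSieve_correlations) : GreenTao2010_pseudorandomDomination :=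
  GreenTao2010_pseudorandomDomination_of_linearForms_of_correlations
    GreenTao2010_envelopingSieve_linearForms_holds h₂

/-- **The Green–Tao–Ziegler theorem from the correlation display and the Gowers uniformity
estimate**: with (D.8) proved, `GreenTaoZiegler2012_finiteComplexity` rests on exactly two named
facts of this tree — the correlation estimate of App. D (a consequence of Thm. D.3) and Thm. 7.2
(`GI(s)` and `MN(s)`). [cite: GreenTao2010, Main Theorem, Prop. 6.4, Thm. 7.2]
[cite: GreenTaoZiegler2012, Thm. 1.3 and the following paragraph] -/
theorem GreenTaoZiegler2012_finiteComplexity_of_correlations_of_gowersUniformity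
    (h₂ : GreenTao2010_envelopingSieve_correlations) (hU : GreenTao2010_gowersUniformity) :
    GreenTaoZiegler2012_finiteComplexity :=
  GreenTaoZiegler2012_finiteComplexity_of_linearForms_of_correlations_of_gowersUniformity
    GreenTao2010_envelopingSieve_linearForms_holds h₂ hU

/-- **Green–Tao 2010, Prop. 6.4 ("Domination by a pseudorandom measure"), PROVED**: the named fact
`GreenTao2010_pseudorandomDomination` of `LinearEquationsInPrimesPseudorandom.lean` is a theorem of
this tree — the enveloping-sieve measure of App. D (`…EnvelopingSieveMeasure.lean`), its linear forms
and correlation conditions (`…EnvelopingSieveLinearForms/Correlations.lean`), and the two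
Goldston–Yıldırım displays of App. D now both proved from the smooth Goldston–Yıldırım engine
(`GreenTao2010_envelopingSieve_linearForms_holds`, `GreenTao2010_envelopingSieve_correlations_holds`).
[cite: GreenTao2010, Prop. 6.4 and App. D] -/
theorem GreenTao2010_pseudorandomDomination_holds : GreenTao2010_pseudorandomDomination :=
  GreenTao2010_pseudorandomDomination_of_correlations GreenTao2010_envelopingSieve_correlations_holds

/-- **The Green–Tao–Ziegler theorem from the Gowers uniformity estimate alone**: with §§4, 5, 6
(Prop. 6.4), 7 (the generalised von Neumann theorem), App. C and App. D of *Linear equations in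
primes* all discharged in this tree, `GreenTaoZiegler2012_finiteComplexity` — the Main Theorem of
Green–Tao for systems of finite complexity, unconditional after Green–Tao–Ziegler — rests on exactly
one named fact: Thm. 7.2, the Gowers uniformity of `Λ♭_{b,W} - 1`, i.e. the inverse theorem `GI(s)`
for the `U^{s+1}[N]`-norm (Green–Tao–Ziegler 2012) combined with the Möbius–nilsequences estimate
`MN(s)` (Green–Tao 2012). [cite: GreenTao2010, Main Theorem, Prop. 6.4, Thm. 7.2]
[cite: GreenTaoZiegler2012, Thm. 1.3 and the following paragraph] -/
theorem GreenTaoZiegler2012_finiteComplexity_of_gowersUniformity (hU : GreenTao2010_gowersUniformity) :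
    GreenTaoZiegler2012_finiteComplexity :=
  GreenTaoZiegler2012_finiteComplexity_of_correlations_of_gowersUniformity
    GreenTao2010_envelopingSieve_correlations_holds hU

/-- The linear forms condition for the enveloping-sieve measure (the named fact of
`…EnvelopingSieveMeasure.lean`, part (iii) of the printed proof of Prop. 6.4), PROVED.
[cite: GreenTao2010, App. D (proof of Prop. 6.4, "Let us first verify the `(D,D,D)`-linear forms condition")] -/
theorem GreenTao2010_envelopingSieve_linearFormsCondition_holds : GreenTao2010_envelopingSieve_linearFormsCondition :=
  GreenTao2010_envelopingSieve_linearFormsCondition_of_linearForms GreenTao2010_envelopingSieve_linearForms_holds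

/-- The correlation condition for the enveloping-sieve measure (the named fact of
`…EnvelopingSieveMeasure.lean`, part (iv) of the printed proof of Prop. 6.4), PROVED.
[cite: GreenTao2010, App. D (proof of Prop. 6.4, "Now we verify the `D`-correlation condition for `ν`")] -/
theorem GreenTao2010_envelopingSieve_correlationCondition_holds : GreenTao2010_envelopingSieve_correlationCondition :=
  GreenTao2010_envelopingSieve_correlationCondition_of_linearForms_of_correlations
    GreenTao2010_envelopingSieve_linearForms_holds GreenTao2010_envelopingSieve_correlations_holds

end Literature.NumberTheory.Sieve
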